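import Literature.Geometry.Kaehler.HolomorphicChainFacts
import HarnessLib

/-!
# King's tangent cone theorem: reductions of the statement

Proved reductions of the named fact `Literature.Geometry.Kaehler.King1971_tangentCone`
([Harvey1977, Thm. 1.31]; [Federer1969, 4.3.16–4.3.19]) to more convenient forms, for the provers
of the substantial case:

* `exists_lt_one_subset_ball_of_closure_subset` — an open `W` with compact closure inside
  `B(0,1)` lies in a smaller concentric ball `B(0,ρ)`, `ρ < 1`;
* `King1971_tangentCone_of_balls` — **it suffices to verify Federer's `𝓕^{loc}` neighbourhood
  condition on the concentric balls `B(0,ρ)`, `ρ < 1`** (instead of all open `W ⊂⊂ B(0,1)`):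
  the basic neighbourhoods of [Federer1969, 4.3.16] are monotone in `W`.

No definitions, no named facts.

## References

* R. Harvey, *Holomorphic chains and their boundaries*, PSPUM XXX.1 (1977), Thm. 1.31 [Harvey1977].
* H. Federer, *Geometric Measure Theory*, Springer 1969, 4.3.16 [Federer1969].
-/

open scoped Manifold ContDiff Topology ENNReal Pointwise
open Set Filter MeasureTheory

namespace Literature.Geometry.Kaehler

open Literature.Geometry.GeometricMeasureTheory

-- Nested operator-norm instances on `Covector V m`, as in `Currents.lean`.
set_option maxSynthPendingDepth 2

universe u

/-- An open set with compact closure inside the open unit ball lies in a concentric open ball of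
radius `ρ < 1`. [folklore] -/
theorem exists_lt_one_subset_ball_of_closure_subset {V : Type*} [NormedAddCommGroup V]
    [NormedSpace ℝ V] {W : Set V} (hW : IsCompact (closure W))
    (hW1 : closure W ⊆ Metric.ball (0 : V) 1) :
    ∃ ρ : ℝ, ρ < 1 ∧ W ⊆ Metric.ball (0 : V) ρ := by
  rcases Set.eq_empty_or_nonempty W with rfl | hne
  · exact ⟨0, zero_lt_one, Set.empty_subset _⟩
  · obtain ⟨x₀, hx₀, hmax⟩ :=
      hW.exists_isMaxOn (hne.mono subset_closure) continuous_norm.continuousOn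
    have hx₀1 : ‖x₀‖ < 1 := mem_ball_zero_iff.1 (hW1 hx₀)
    refine ⟨(‖x₀‖ + 1) / 2, by linarith, fun w hw => mem_ball_zero_iff.2 ?_⟩
    have hle : ‖w‖ ≤ ‖x₀‖ := hmax (subset_closure hw)
    linarith

/-- **Reduction of King's theorem to concentric balls.** To prove `King1971_tangentCone` it
suffices to produce, for every chain `T`, base point `b ∈ Ω`, the cone `C` and to verify the
`𝓕^{loc}_{2p}(B(0,1))` neighbourhood condition `spt((1/r)_*(τ_{-b})_*[T] − [C] − R − ∂S) ∩ W = ∅`,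
`𝐌(R) + 𝐌(S) < δ` only for the balls `W = B(0,ρ)`, `ρ < 1` (every admissible `W` lies in one of
them, and the condition is monotone in `W`). [cite: Federer1969, 4.3.16] -/
theorem King1971_tangentCone_of_balls
    (h : ∀ (V : Type u) [NormedAddCommGroup V] [InnerProductSpace ℂ V] [FiniteDimensional ℂ V]
      [MeasurableSpace V] [BorelSpace V] (Ω : TopologicalSpace.Opens V) (p : ℕ)
      (T : HolomorphicChain 𝓘(ℂ, V) Ω p) (b : V), b ∈ Ω →
      letI : InnerProductSpace ℝ V := InnerProductSpace.complexToReal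
      ∃ C : HolomorphicChain 𝓘(ℂ, V) (⊤ : TopologicalSpace.Opens V) p,
        (∀ x ∈ C.support, ∀ c : ℂ,
          (⟨c • (x : V), trivial⟩ : (⊤ : TopologicalSpace.Opens V)) ∈ C.support) ∧
        ∀ ρ : ℝ, ρ < 1 → ∀ δ : ℝ≥0∞, 0 < δ → ∀ᶠ r in 𝓝[>] (0 : ℝ),
          ∃ (R : Current (unitBall V) (2 * p)) (S : Current (unitBall V) (2 * p + 1)),
            R.IsRectifiable ∧ S.IsRectifiable ∧
            (T.blowUp b r - C.toCurrentIn (unitBall V) - R - S.boundary).support ∩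
              Metric.ball (0 : V) ρ = ∅ ∧
            R.mass + S.mass < δ) :
    King1971_tangentCone.{u} := by
  intro V _ _ _ _ _ Ω p T b hb
  letI : InnerProductSpace ℝ V := InnerProductSpace.complexToReal
  obtain ⟨C, hC, hballs⟩ := h V Ω p T b hb
  refine ⟨C, hC, fun W _ hWc hW1 δ hδ => ?_⟩
  obtain ⟨ρ, hρ, hWρ⟩ := exists_lt_one_subset_ball_of_closure_subset hWc hW1
  filter_upwards [hballs ρ hρ δ hδ] with r hr
  obtain ⟨R, S, hR, hS, hspt, hmass⟩ := hr
  refine ⟨R, S, hR, hS, ?_, hmass⟩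
  exact Set.eq_empty_of_subset_empty
    ((Set.inter_subset_inter_right _ hWρ).trans hspt.subset)

end Literature.Geometry.Kaehler
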